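import Summits.BirchSwinnertonDyer.Rank1Residual.O5.HeegnerLogTransportThreeChain
import Literature.NumberTheory.EllipticCurves.PastenValuationProductThm115Proofs
import Literature.NumberTheory.EllipticCurves.HeegnerPointsKolyvaginTorsionProofs
import HarnessLib
import HarnessLib.Audit.Tags

/-!
# KL3 — the W-side of the Heegner-log transport chain in T-O5-B's currency (o5-r2 GEN 16, file D)

Companion to `O5/HeegnerLogTransportThree.lean` (vocabulary, KL3-A/A′/B/M, §2d) and
`O5/HeegnerLogTransportThreeChain.lean` (§2e log step, §2f L1, §2g composition). This file discharges
the two side conditions of §2g that are not literally T-O5-B hypotheses: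

* `W(K)[3] = 0` — from `K` imaginary quadratic, `3 ≠ 2` and `ρ̄_{E,3}` onto, by the tree theorem
  `Literature.NumberTheory.EllipticCurves.torsionBy_eq_bot_of_isImaginaryQuadratic` (Gross 1991, §2);
* `3 ∤ c₃(W) = [W(ℚ₃) : W₀(ℚ₃)]` — from `3 ∤ Tam(W) = ∏_v c_v` (`WeierstrassCurve.tamagawaProduct`), by the
  tree theorem `tamagawaProduct_eq_prod` (the `finprod` is the finite product over the bad places and
  `c_v = 1` at the good ones, `localTamagawaNumber_padic_eq_one_of_hasGoodReductionAt`);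

and restates §2g with exactly T-O5-B's hypotheses on the `W`-side
(`padicValNat_index_eq_zero_of_companion_unit'`): modulo KL3-A (Kriz–Li, FMS 7 (2019) e15,
Thm. 1.16 — a theorem in print, carried as the hypothesis `hA`) the lower-half bit
`ord₃ [W(K) : ℤ P] = 0` of T-O5-B follows from the COMPANION-side unit statement (the conclusion of
KL3-D `GoodHeegnerLogUnitThree`, OPEN = Wan's divisibility at `p = 3`) plus unit depletion factors and
Manin constants. Everything here is PROVED; no new conjecture node, no new candidate fact; HONEST
FRAMING: research route, nothing booked, no RESIDUAL-MAP mark moved.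

Sources: [KrizLi2019] D. Kriz, C. Li, Forum Math. Sigma 7 (2019) e15, Thm. 1.16, Rem. 1.17
(arXiv:1606.03172); [GrossLMS1991] B. Gross, LMS LN 153 (1991), §2; [SilvermanAEC2009] J. Silverman,
GTM 106, VII.6 and C.16.

TYPER PLACEMENT NOTE (cc-typer-5 GEN 17 = O5 §3.5 / O6 §3.4 typer of record; ask A-O5-G16-4 of o5-r2 GEN 16 BY NAME, HOME/INBOX.md l.13326;
docket cc-lead ⟦gen71⟧ (2′) (c32) 'item D of the cut', HOME/INBOX.md l.13361).  Source of record: `HOME/b2b-bsdres-o5-r2/gen16/lean/HeegnerLogTransportThreeGlobal.lean`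
sha16 `7fc7a082fdb8a24d` (132 l.; o5-r2's `lean check` against the tree rc 0 at 21:03Z; re-hashed and farm-checked by the typer right before writing); placed
VERBATIM — this paragraph is the only addition; every declaration block byte-identical to the source.  THEOREMS ONLY (3, PROVED; 0 def, 0 named fact,
`@[conjecture]` × 0, no `sorry`); the one displayed hypothesis is `hA : KrizLiUnitBitTransportThree` (KL3-A = Kriz–Li Thm. 1.16, typed as a plain-def
THEOREM-CANDIDATE in `O5/HeegnerLogTransportThree.lean` p340741) and the companion-side unit statement.  Siblings: part 1 p340741, part 2
`O5/HeegnerLogTransportThreeChain.lean` p341262 (imported here), part 3 `O5/HeegnerLogTransportThreeTargets.lean` p341640.  HONEST FRAMING (cell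
`b2b-bsdres`): research route, lane CLASS-CLOSURE §3.5 O5; nothing asserted beyond the displayed binders, nothing booked, no mark of `RESIDUAL-MAP.md` moves;
census C-KL3-V = EVIDENCE only; O5 OPEN.
-/

noncomputable section

open scoped Classical

open WeierstrassCurve Literature.NumberTheory.EllipticCurves
  Literature.NumberTheory.EllipticCurves.ModularForms
  Literature.NumberTheory.EllipticCurves.Rank1Residual
  Literature.NumberTheory.EllipticCurves.Rank1Residual.Typed

namespace Summit.BirchSwinnertonDyer.Rank1Residual.O5.HeegnerLogTransport

open Summit.BirchSwinnertonDyer.Rank1Residual.X11b (padicLogOrd embAt padicPointOf)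
open IsDedekindDomain Rat.HeightOneSpectrum
open scoped NumberField

/-! ## §2h Discharging the side conditions of §2g from T-O5-B's own hypotheses (W-side in route currency) -/

section Global

/-- Discharge of the `W(K)[p] = 0` hypothesis (`htors`) of §2f/§2g from the T-O5-B hypotheses:
`K` imaginary quadratic, `p` odd, `ρ̄_{E,p}` onto ⇒ `E(K)[p] = 0` (tree theorem
`torsionBy_eq_bot_of_isImaginaryQuadratic`, Gross 1991 §2). [cite: GrossLMS1991, §2 (sentence after (2.2))] -/
theorem nsmul_eq_zero_imp_eq_zero_of_surj (W : WeierstrassCurve ℚ) [W.IsElliptic]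
    (K : Type) [Field K] [NumberField K] (hK : IsImaginaryQuadratic K) {p : ℕ} [hp : Fact p.Prime]
    (hp2 : p ≠ 2) (hρ : W.HasSurjectiveModNGaloisRep p) :
    ∀ R : (W.baseChange K).toAffine.Point, p • R = 0 → R = 0 := by
  intro R hR
  have hbot := torsionBy_eq_bot_of_isImaginaryQuadratic W K hK hp.out hp2 hρ
  have hmem : R ∈ AddSubgroup.torsionBy (W.baseChange K).toAffine.Point (p : ℤ) :=
    AddSubgroup.torsionBy.nsmul_iff.mpr hR
  rw [hbot] at hmem
  exact (AddSubgroup.mem_bot).mp hmem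

/-- Local ↔ global Tamagawa bookkeeping: a prime not dividing `Tam(E) = ∏ c_v` does not divide the
local Tamagawa number `c_p = [E(ℚ_p) : E₀(ℚ_p)]` (`Tam(E)` is the finite product of the `c_v` over
the bad places, `c_v = 1` at the good ones; tree `tamagawaProduct_eq_prod`). Discharges `hc3` of §2g
from T-O5-B's `¬ 3 ∣ tamagawaProduct`. [folklore] -/
theorem not_dvd_localTamagawaNumber_of_not_dvd_tamagawaProduct (W : WeierstrassCurve ℚ)
    [W.IsElliptic] {p : ℕ} [hp : Fact p.Prime] (h : ¬ p ∣ W.tamagawaProduct) :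
    ¬ p ∣ (W.baseChange ℚ_[p]).localTamagawaNumber ℤ_[p] := by
  intro hdvd
  have hfin : (W.badPlaces ℤ).Finite := W.finite_badPlaces_holds ℤ
  have hs : ∀ v, ¬ W.HasGoodReductionAt v → v ∈ hfin.toFinset := fun v hv => by
    rw [Set.Finite.mem_toFinset, mem_badPlaces_iff]
    exact hv
  set v₀ : HeightOneSpectrum ℤ := (primesEquiv (R := ℤ)).symm ⟨p, hp.out⟩ with hv₀
  have hpv : primesEquiv v₀ = ⟨p, hp.out⟩ := Equiv.apply_symm_apply _ _
  have key : ∀ q : Nat.Primes, q = ⟨p, hp.out⟩ →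
      (p ∣ (haveI := Fact.mk q.2; (W.baseChange ℚ_[(q : ℕ)]).localTamagawaNumber ℤ_[(q : ℕ)])) := by
    rintro q rfl
    exact hdvd
  by_cases hmem : v₀ ∈ hfin.toFinset
  · apply h
    rw [tamagawaProduct_eq_prod W _ hs]
    exact dvd_trans (key _ hpv) (Finset.dvd_prod_of_mem _ hmem)
  · have hgood : W.HasGoodReductionAt v₀ := by
      by_contra hng
      exact hmem (hs v₀ hng)
    have h1 := localTamagawaNumber_padic_eq_one_of_hasGoodReductionAt W v₀ hgood
    have h2 := key _ hpv
    rw [h1] at h2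
    exact hp.out.one_lt.ne' (Nat.dvd_one.mp h2)

/-- **The W-side of the KL3 chain in T-O5-B's currency (kernel-checked modulo KL3-A).** As
`padicValNat_index_eq_zero_of_companion_unit`, with the side conditions `W(K)[3] = 0` and `3 ∤ c₃(W)`
replaced by T-O5-B's own hypotheses `ρ̄_{E,3}` onto and `3 ∤ ∏_q c_q(E)`: KL3-A + a mod-3 companion
`G` whose Heegner log is a unit in Kriz–Li's normalisation (+ off-3 depletion units, Manin units,
`Addv W 3`, `a₃(W) = 0`) ⇒ `ord₃ [W(K) : ℤP] = 0`. What remains to KL3-C♭ is the COMPANION side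
(KL3-B/M → KL3-D) and the choice `ι₃ = embAt` (any `ι₃` works here). [cite: KrizLi2019, Thm. 1.16, Rem. 1.17] -/
theorem padicValNat_index_eq_zero_of_companion_unit' (hA : KrizLiUnitBitTransportThree)
    (W G : WeierstrassCurve ℚ) [W.IsElliptic] [W.IsGloballyMinimal] [G.IsElliptic] [G.IsGloballyMinimal]
    (hcong : ∀ ℓ : ℕ, ℓ.Prime → ¬ (ℓ ∣ 3 * W.conductorNorm ℤ * G.conductorNorm ℤ) →
      ((W.LFunction ℓ : ℤ) : ZMod 3) = ((G.LFunction ℓ : ℤ) : ZMod 3))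
    (hρ : W.HasSurjectiveModNGaloisRep 3) (hadd : Addv W 3) (hWa3 : W.LFunction 3 = 0)
    (hNW : W.conductorNorm ℤ ≠ 0) (hNG : G.conductorNorm ℤ ≠ 0)
    (hunitW : ∀ ℓ ∈ klSet W G, ℓ ≠ 3 → padicValInt 3 (nsCount W ℓ) = 0)
    (hunitG : ∀ ℓ ∈ klSet G W, ℓ ≠ 3 → padicValInt 3 (nsCount G ℓ) = 0)
    (htam : ¬ 3 ∣ W.tamagawaProduct)
    {N N' : ℕ} [NeZero N] [NeZero N'] (D : ModularParametrizationData W N)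
    (D' : ModularParametrizationData G N')
    (K : Type) [Field K] [NumberField K] (hK : IsImaginaryQuadratic K)
    (hH : SatisfiesHeegnerHypothesis N K) (hH' : SatisfiesHeegnerHypothesis N' K)
    (hd : NumberField.discr K < -4) (h3d : ¬ ((3 : ℤ) ∣ NumberField.discr K))
    (H : HeegnerDatum N (NumberField.discr K)) (H' : HeegnerDatum N' (NumberField.discr K))
    (ι : K →+* ℂ) (ι₃ : K →+* ℚ_[3])
    (P : (W.baseChange K).toAffine.Point) (P' : (G.baseChange K).toAffine.Point)
    (hP : WeierstrassCurve.Affine.Point.map ι.toRatAlgHom P = heegnerPointComplex D H)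
    (hP' : WeierstrassCurve.Affine.Point.map ι.toRatAlgHom P' = heegnerPointComplex D' H')
    (hPinf : ¬ IsOfFinAddOrder P) (hP'inf : ¬ IsOfFinAddOrder P')
    (hcD : padicValInt 3 D.maninConstant = 0) (hcD' : padicValInt 3 D'.maninConstant = 0)
    (hGunit : padicLogOrd G 3 ι₃ P' + padicValInt 3 (nsCount G 3) - 1 = 0) :
    padicValNat 3 (AddSubgroup.zmultiples P).index = 0 :=
  padicValNat_index_eq_zero_of_companion_unit hA W G hcong hadd hWa3 hNW hNG hunitW hunitG
    (not_dvd_localTamagawaNumber_of_not_dvd_tamagawaProduct W htam) D D' K hK hH hH' hd h3d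
    (nsmul_eq_zero_imp_eq_zero_of_surj W K hK (by norm_num) hρ) H H' ι ι₃ P P' hP hP' hPinf hP'inf
    hcD hcD' hGunit

end Global

end Summit.BirchSwinnertonDyer.Rank1Residual.O5.HeegnerLogTransport
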